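import Summits.QuantumAdvantage.QuantumAdvantage.Theorems.CubicForrelationNearExactIsExactTowerWalk
import Summits.QuantumAdvantage.QuantumAdvantage.Theorems.NearExactIsExact.Negative.SmallCases

/-!
# Crux `CubicForrelation.NearExactIsExact` (stmt-QuantumAdvantage-14043) — `7/8` isolates exactness for every even `n ≤ 8`,
  `1 − 2⁻¹⁰` for every even `n ≤ 28`; the crux is equivalent to its restriction to `n ≥ 30`

Line `direct-sum-amplification`, lead c6 (companion of `…IsolationSmallN.lean` and `…TowerWalk.lean`). COMPUTATIONAL file: it
combines the computation-free tower theorems (`isolation_eight`: cubic pairs on 8 bits have `Φ > 7/8 ⇒ Φ = 1`;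
`isolation_ten/…/sixteen`; `isolation_window_le_28`: `Φ > 1 − 2⁻¹⁰ ⇒ Φ = 1` on `6 ≤ n ≤ 28` bits) with the certified-compute
seat's `nearExact78_le_six` (`Theorems/NearExactIsExact/Negative/SmallCases.lean`, an in-tree `native_decide` checker for
`n ≤ 6`), so its closure carries the `native_decide` axioms of that certificate and nothing else non-standard.

* `nearExact78_le_eight`: for every even `n ≤ 8` and all cubic `f, g` on `n` bits, `Φ(f,g) > 7/8 ⇒ Φ(f,g) = 1`.
* `nearExactIsExact_iff_from_ten`: `NearExactIsExact ↔ ∃ θ < 1` isolating exactness for cubic pairs on every even `n ≥ 10`.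
* `isolation_le_sixteen`: for every even `n ≤ 16`, `Φ > 63/64 ⇒ Φ = 1`.
* `isolation_window_below_thirty`: for every even `n ≤ 28`, `Φ > 1 − 2⁻¹⁰ ⇒ Φ = 1`.
* `nearExactIsExact_iff_from_thirty`: `NearExactIsExact ↔ ∃ θ < 1` isolating exactness for cubic pairs on every even `n ≥ 30` —
  the crux's open core (both branches of the line's skeleton) is a statement about `n ≥ 30` only.

Sources: as in the imported files (Ax 1964 / McEliece 1972, Rothaus 1976, Hou 1998, Carlet 2021, Aaronson–Ambainis 2018).
-/

set_option linter.dupNamespace false -- D-0017: single-problem summit ⇒ `QuantumAdvantage.QuantumAdvantage` by design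

noncomputable section

namespace Summit.QuantumAdvantage.QuantumAdvantage.Theorems.CubicForrelation.NearExactIsExact

open Finset
open Literature.Computability.QuantumComplexity
open Summit.QuantumAdvantage.QuantumAdvantage.Theorems.NearExactIsExact.Negative.SmallCases (nearExact78_le_six)
open Summit.QuantumAdvantage.QuantumAdvantage.Theses.CubicForrelation (NearExactIsExact)

/-! ### `7/8` works for every `n ≤ 8`, so only `n ≥ 10` matters -/

/-- **Isolation at `7/8` for all even `n ≤ 8`.** For every even `n ≤ 8` and all cubic `f, g` on `n` bits,
`Φ(f,g) > 7/8 ⇒ Φ(f,g) = 1` (`n ≤ 6`: the certified-compute seat's `nearExact78_le_six`; `n = 8`: `isolation_eight`).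
Counterexamples at `7/8` (which exist: `Φ = 15/16` at `n = 16`) need `n ≥ 10`. -/
theorem nearExact78_le_eight : ∀ n : ℕ, n ≤ 8 → Even n → ∀ f g : (Fin n → Bool) → Bool,
    IsDegLeFun 3 f → IsDegLeFun 3 g → 7 / 8 < forrelation f g → forrelation f g = 1 := by
  intro n hn he f g hf hg hlt
  by_cases h6 : n ≤ 6
  · exact nearExact78_le_six n h6 he f g hf hg hlt
  · obtain ⟨m, rfl⟩ := he
    obtain rfl : m = 4 := by omega
    exact isolation_eight f g hf hg hlt

/-- **The crux reduces to `n ≥ 10`.** `NearExactIsExact` holds iff some `θ < 1` isolates exactness for cubic pairs on every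
even `n ≥ 10`: below `10` the threshold `7/8` already works (`nearExact78_le_eight`), so `max θ (7/8)` serves all `n`.
[folklore] -/
theorem nearExactIsExact_iff_from_ten :
    NearExactIsExact ↔ ∃ θ : ℝ, θ < 1 ∧ ∀ n : ℕ, Even n → 10 ≤ n → ∀ f g : (Fin n → Bool) → Bool,
      IsDegLeFun 3 f → IsDegLeFun 3 g → θ < forrelation f g → forrelation f g = 1 := by
  constructor
  · rintro ⟨θ, hθ, h⟩
    exact ⟨θ, hθ, fun n hn _ f g hf hg hlt => h n hn f g hf hg hlt⟩
  · rintro ⟨θ, hθ, h⟩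
    refine ⟨max θ (7 / 8), max_lt hθ (by norm_num), fun n hn f g hf hg hlt => ?_⟩
    by_cases h10 : 10 ≤ n
    · exact h n hn h10 f g hf hg (lt_of_le_of_lt (le_max_left _ _) hlt)
    · have h8 : n ≤ 8 := by obtain ⟨k, hk⟩ := hn; omega
      exact nearExact78_le_eight n h8 hn f g hf hg (lt_of_le_of_lt (le_max_right _ _) hlt)

/-- **`63/64` isolates exactness for every even `n ≤ 16`.** For every even `n ≤ 16` and all cubic `f, g` on `n` bits,
`Φ(f,g) > 63/64 ⇒ Φ(f,g) = 1` (the tower's constants `7/8, 15/16, 31/32, 31/32, 63/64` at `n = 8, 10, 12, 14, 16`, and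
`7/8` below). -/
theorem isolation_le_sixteen : ∀ n : ℕ, n ≤ 16 → Even n → ∀ f g : (Fin n → Bool) → Bool,
    IsDegLeFun 3 f → IsDegLeFun 3 g → 63 / 64 < forrelation f g → forrelation f g = 1 := by
  intro n hn he f g hf hg hlt
  by_cases h8 : n ≤ 8
  · exact nearExact78_le_eight n h8 he f g hf hg (by linarith)
  · obtain ⟨m, rfl⟩ := he
    have hm : 5 ≤ m ∧ m ≤ 8 := by omega
    obtain ⟨hm5, hm8⟩ := hm
    interval_cases m
    · exact isolation_ten f g hf hg (by linarith)
    · exact isolation_twelve f g hf hg (by linarith)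
    · exact isolation_fourteen f g hf hg (by linarith)
    · exact isolation_sixteen f g hf hg hlt

/-! ### `1 − 2⁻¹⁰` works for every `n ≤ 28`, so the crux's open core lives at `n ≥ 30` -/

/-- **`1 − 2⁻¹⁰` isolates exactness for every even `n ≤ 28`.** For every even `n ≤ 28` and all cubic `f, g` on `n` bits,
`Φ(f,g) > 1 − 2⁻¹⁰ ⇒ Φ(f,g) = 1` (`n ≤ 4`: `7/8` already works; `6 ≤ n ≤ 28`: the tower walk `isolation_window_le_28`). -/
theorem isolation_window_below_thirty : ∀ n : ℕ, n ≤ 28 → Even n → ∀ f g : (Fin n → Bool) → Bool,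
    IsDegLeFun 3 f → IsDegLeFun 3 g → 1 - 1 / 1024 < forrelation f g → forrelation f g = 1 := by
  intro n hn he f g hf hg hlt
  by_cases h4 : n ≤ 4
  · exact nearExact78_le_eight n (by omega) he f g hf hg (by linarith)
  · obtain ⟨m, rfl⟩ := he
    exact isolation_window_le_28 m (by omega) (by omega) f g hf hg hlt

/-- **The crux reduces to `n ≥ 30`.** `NearExactIsExact` holds iff some `θ < 1` isolates exactness for cubic pairs on every even
`n ≥ 30`: below `30` the threshold `1 − 2⁻¹⁰` already works (`isolation_window_below_thirty`), so `max θ (1 − 2⁻¹⁰)` serves all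
`n`.  (The line's skeleton says the same structurally: the bent core starts at `n = 42` by Hou, the non-bent core at `n = 30` by
the tower walk.) [folklore] -/
theorem nearExactIsExact_iff_from_thirty :
    NearExactIsExact ↔ ∃ θ : ℝ, θ < 1 ∧ ∀ n : ℕ, Even n → 30 ≤ n → ∀ f g : (Fin n → Bool) → Bool,
      IsDegLeFun 3 f → IsDegLeFun 3 g → θ < forrelation f g → forrelation f g = 1 := by
  constructor
  · rintro ⟨θ, hθ, h⟩
    exact ⟨θ, hθ, fun n hn _ f g hf hg hlt => h n hn f g hf hg hlt⟩
  · rintro ⟨θ, hθ, h⟩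
    refine ⟨max θ (1 - 1 / 1024), max_lt hθ (by norm_num), fun n hn f g hf hg hlt => ?_⟩
    by_cases h30 : 30 ≤ n
    · exact h n hn h30 f g hf hg (lt_of_le_of_lt (le_max_left _ _) hlt)
    · have h28 : n ≤ 28 := by obtain ⟨k, hk⟩ := hn; omega
      exact isolation_window_below_thirty n h28 hn f g hf hg (lt_of_le_of_lt (le_max_right _ _) hlt)

end Summit.QuantumAdvantage.QuantumAdvantage.Theorems.CubicForrelation.NearExactIsExact

end
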